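import Mathlib
import Summits.ValiantsHypothesis.ValiantsHypothesis.Theorems.NewtonUnitEquationsDissociatedUniformBlockStep

/-!
# Lex-greedy sets along a pencil of heights, III: the sweep and chart monotonicity (Theorem Q, part Q3)

`lexGreedy_chart_monotone`: along a chart `λ ↦ u + λ v` of heights on a finite vector configuration `x : E → ℂ^k`, if all
lex-greedy sets at injective parameters lie in `U ⊆ E`, then for injective parameters `λ₁ ≤ λ₂` the rank potential
`Ψ(λ) = Σ_{e ∈ greedy(λ) ∩ U} #{e' ∈ U : v e' < v e}` satisfies `Ψ(λ₁) ≤ Ψ(λ₂)`, with equality only if the greedy sets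
coincide.  Proof: the order at a parameter just below / above a critical value `c` is the lexicographic order
`(height at c, ∓ slope)` (`lex_below`, `lex_above`), so crossing `c` is a block step (`BlockStep.sum_rk_le`); induct over the
finitely many critical values in `(λ₁, λ₂)` (`Sweep.sweep`).  Part of Theorem Q of line `greedy-basis-shadow`
(crux stmt-ValiantsHypothesis-5905). [folklore: the parametric-matroid exchange count]
-/

set_option linter.dupNamespace false

namespace Summit.ValiantsHypothesis.ValiantsHypothesis.Theorems.NewtonUnitEquationsDissociatedUniform

open scoped BigOperators

namespace Sweep

variable {α : Type} {K V : Type*} [DivisionRing K] [AddCommGroup V] [Module K V]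

open scoped Classical

/-- **At a critical value** with nothing else critical in `[a, c]`, the order at `a < c` is the lexicographic order
`(height at c, descending slope)`. -/
theorem lex_below (E : Finset α) (u v : α → ℝ) {a c : ℝ} (hac : a < c)
    (hfree : ∀ c' ∈ crit E u v, a ≤ c' → c' ≤ c → c' = c) :
    ∀ e ∈ E, ∀ e' ∈ E, hgt u v a e < hgt u v a e' ↔
      (hgt u v c e < hgt u v c e' ∨ (hgt u v c e = hgt u v c e' ∧ v e' < v e)) := by
  intro e he e' he'
  have hlin : ∀ t : ℝ, hgt u v t e' - hgt u v t e = (hgt u v c e' - hgt u v c e) + (t - c) * (v e' - v e) := by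
    intro t; unfold hgt; ring
  constructor
  · intro hlt
    rcases lt_trichotomy (hgt u v c e) (hgt u v c e') with h | h | h
    · exact Or.inl h
    · right; refine ⟨h, ?_⟩
      have := hlin a
      rw [h, sub_self, zero_add] at this
      have hpos : 0 < (a - c) * (v e' - v e) := by rw [← this]; linarith
      nlinarith
    · -- order reversed between `a` and `c`: a critical value in between, contradiction
      exfalso
      by_cases hv : v e = v e'
      · have := hlin a; rw [hv, sub_self, mul_zero, add_zero] at this; linarith
      · set μ := (u e' - u e) / (v e - v e') with hμ
        have hroot : hgt u v μ e = hgt u v μ e' := by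
          unfold hgt; rw [hμ]; have : v e - v e' ≠ 0 := sub_ne_zero.mpr hv
          field_simp; ring
        have hμcrit := mem_crit_of_eq E u v he he' hv hroot
        have hl2 : ∀ t : ℝ, hgt u v t e' - hgt u v t e = (u e' - u e) + t * (v e' - v e) := by
          intro t; unfold hgt; ring
        have h1 : 0 < (u e' - u e) + a * (v e' - v e) := by rw [← hl2]; linarith
        have h2 : (u e' - u e) + c * (v e' - v e) < 0 := by rw [← hl2]; linarith
        have h3 : (u e' - u e) + μ * (v e' - v e) = 0 := by rw [← hl2, hroot, sub_self]
        have hvne : v e' - v e ≠ 0 := sub_ne_zero.mpr (Ne.symm hv)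
        have haμ : a ≤ μ := by
          by_contra h'; push Not at h'
          rcases lt_or_gt_of_ne hvne with hneg | hpos <;> nlinarith
        have hμc : μ ≤ c := by
          by_contra h'; push Not at h'
          rcases lt_or_gt_of_ne hvne with hneg | hpos <;> nlinarith
        have := hfree μ hμcrit haμ hμc
        rw [this] at h3
        linarith
  · rintro (h | ⟨h, hv⟩)
    · -- strict at `c`, persists down to `a` unless a critical value intervenes
      by_contra hge; push Not at hge
      rcases hge.lt_or_eq with hlt' | heq
      · by_cases hv : v e = v e'
        · have := hlin a; rw [hv, sub_self, mul_zero, add_zero] at this; linarith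
        · set μ := (u e' - u e) / (v e - v e') with hμ
          have hroot : hgt u v μ e = hgt u v μ e' := by
            unfold hgt; rw [hμ]; have : v e - v e' ≠ 0 := sub_ne_zero.mpr hv
            field_simp; ring
          have hμcrit := mem_crit_of_eq E u v he he' hv hroot
          have hl2 : ∀ t : ℝ, hgt u v t e' - hgt u v t e = (u e' - u e) + t * (v e' - v e) := by
            intro t; unfold hgt; ring
          have h1 : (u e' - u e) + a * (v e' - v e) < 0 := by rw [← hl2]; linarith
          have h2 : 0 < (u e' - u e) + c * (v e' - v e) := by rw [← hl2]; linarith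
          have h3 : (u e' - u e) + μ * (v e' - v e) = 0 := by rw [← hl2, hroot, sub_self]
          have hvne : v e' - v e ≠ 0 := sub_ne_zero.mpr (Ne.symm hv)
          have haμ : a ≤ μ := by
            by_contra h'; push Not at h'
            rcases lt_or_gt_of_ne hvne with hneg | hpos <;> nlinarith
          have hμc : μ ≤ c := by
            by_contra h'; push Not at h'
            rcases lt_or_gt_of_ne hvne with hneg | hpos <;> nlinarith
          have := hfree μ hμcrit haμ hμc
          rw [this] at h3
          linarith
      · -- equal at `a`: `a` critical (≠ c) or slopes equal; both contradict strictness at `c`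
        by_cases hv : v e = v e'
        · have := hlin a; rw [hv, sub_self, mul_zero, add_zero, heq, sub_self] at this; linarith
        · have hacrit := mem_crit_of_eq E u v he he' hv heq.symm
          have := hfree a hacrit le_rfl hac.le
          linarith
    · have := hlin a
      rw [h, sub_self, zero_add] at this
      have : 0 < hgt u v a e' - hgt u v a e := by
        rw [this]; nlinarith
      linarith

/-- The mirror statement of `lex_below` above the critical value (by reflecting the parameter). -/
theorem lex_above (E : Finset α) (u v : α → ℝ) {c b : ℝ} (hcb : c < b)
    (hfree : ∀ c' ∈ crit E u v, c ≤ c' → c' ≤ b → c' = c) :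
    ∀ e ∈ E, ∀ e' ∈ E, hgt u v b e < hgt u v b e' ↔
      (hgt u v c e < hgt u v c e' ∨ (hgt u v c e = hgt u v c e' ∧ v e < v e')) := by
  -- reflect the parameter: `hgt u v t = hgt u (-v) (-t)`, and `-b < -c`
  have hrefl : ∀ t : ℝ, ∀ e : α, hgt u v t e = hgt u (fun a => -v a) (-t) e := by
    intro t e; unfold hgt; ring
  have hcrit : ∀ c' ∈ crit E u (fun a => -v a), -b ≤ c' → c' ≤ -c → c' = -c := by
    intro c' hc' h1 h2
    have hneg : -c' ∈ crit E u v := by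
      unfold crit at hc' ⊢
      obtain ⟨p, hp, rfl⟩ := Finset.mem_image.mp hc'
      obtain ⟨hp1, hvp⟩ := Finset.mem_filter.mp hp
      refine Finset.mem_image.mpr ⟨p, Finset.mem_filter.mpr ⟨hp1, fun h => hvp (by simp [h])⟩, ?_⟩
      have : v p.1 - v p.2 ≠ 0 := sub_ne_zero.mpr fun h => hvp (by simp [h])
      have : -v p.1 - -v p.2 ≠ 0 := by intro h'; apply this; linarith
      field_simp
      ring
    have := hfree (-c') hneg (by linarith) (by linarith)
    linarith
  intro e he e' he'
  have h := lex_below E u (fun a => -v a) (a := -b) (c := -c) (by linarith) hcrit e he e' he'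
  simp only [← hrefl, neg_lt_neg_iff] at h
  exact h


/-! ### The induction over critical values and the registered statement -/

section Induction

variable [Module.Finite K V]

/-- The potential: `U`-rank sum of the greedy set at parameter `lam`. -/
noncomputable def pot (E U : Finset α) (x : α → V) (u v : α → ℝ) (lam : ℝ) : ℕ :=
  ∑ e ∈ E.filter (fun e => e ∈ GreedyGale.gset (K := K) E x (hgt u v lam)), BlockStep.rk U v e

/-- **The sweep.**  Along the chart the potential is monotone in the parameter and separates distinct greedy sets, by
strong induction on the number of critical values strictly between the two parameters. [folklore] -/
theorem sweep (E U : Finset α) (x : α → V) (u v : α → ℝ)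
    (hU : ∀ lam : ℝ, Set.InjOn (hgt u v lam) E → ∀ e ∈ E, e ∈ GreedyGale.gset (K := K) E x (hgt u v lam) → e ∈ U) :
    ∀ n : ℕ, ∀ a b : ℝ, a ≤ b → Set.InjOn (hgt u v a) E → Set.InjOn (hgt u v b) E →
      ((crit E u v).filter fun c => a < c ∧ c < b).card = n →
      pot (K := K) E U x u v a ≤ pot (K := K) E U x u v b ∧
      (pot (K := K) E U x u v a = pot (K := K) E U x u v b →
        E.filter (fun e => e ∈ GreedyGale.gset (K := K) E x (hgt u v a)) =
          E.filter (fun e => e ∈ GreedyGale.gset (K := K) E x (hgt u v b))) := by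
  intro n
  induction n using Nat.strong_induction_on with
  | _ n ih =>
  intro a b hab ha hb hcard
  set C := (crit E u v).filter fun c => a < c ∧ c < b with hC
  have haC : a ∉ crit E u v := not_mem_crit_of_injOn E u v ha
  have hbC : b ∉ crit E u v := not_mem_crit_of_injOn E u v hb
  rcases C.eq_empty_or_nonempty with hCe | hCne
  · -- no critical value in `[a, b]`: same order, same greedy set
    have hfree : ∀ c ∈ crit E u v, ¬ (a ≤ c ∧ c ≤ b) := by
      rintro c hc ⟨h1, h2⟩
      rcases h1.lt_or_eq with h1 | h1
      · rcases h2.lt_or_eq with h2 | h2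
        · have : c ∈ C := Finset.mem_filter.mpr ⟨hc, h1, h2⟩
          rw [hCe] at this; exact absurd this (Finset.notMem_empty c)
        · exact hbC (h2 ▸ hc)
      · exact haC (h1 ▸ hc)
    have hG : GreedyGale.gset (K := K) E x (hgt u v a) = GreedyGale.gset (K := K) E x (hgt u v b) :=
      gset_congr E x fun e he e' he' => lt_iff_lt_of_no_crit E u v hab hfree he he'
    refine ⟨?_, fun _ => ?_⟩
    · simp only [pot, hG]; exact le_rfl
    · simp only [hG]
  · -- the smallest critical value `c` in `(a, b)`
    set c := C.min' hCne with hc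
    have hcC : c ∈ C := Finset.min'_mem C hCne
    obtain ⟨hccrit, hac, hcb⟩ := Finset.mem_filter.mp hcC
    have hcmin : ∀ c' ∈ C, c ≤ c' := fun c' hc' => Finset.min'_le C c' hc'
    -- the next critical value `c₂` (or `b`)
    set C' := C.filter fun c' => c < c' with hC'
    have hc₂ : ∃ c₂ : ℝ, c < c₂ ∧ c₂ ≤ b ∧ ∀ c' ∈ crit E u v, c < c' → c' < c₂ → False := by
      rcases C'.eq_empty_or_nonempty with hC'e | hC'ne
      · refine ⟨b, hcb, le_rfl, fun c' hc' h1 h2 => ?_⟩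
        have : c' ∈ C' := Finset.mem_filter.mpr ⟨Finset.mem_filter.mpr ⟨hc', hac.trans h1, h2⟩, h1⟩
        rw [hC'e] at this; exact Finset.notMem_empty c' this
      · refine ⟨C'.min' hC'ne, ?_, ?_, fun c' hc' h1 h2 => ?_⟩
        · exact (Finset.mem_filter.mp (Finset.min'_mem C' hC'ne)).2
        · exact (Finset.mem_filter.mp (Finset.mem_filter.mp (Finset.min'_mem C' hC'ne)).1).2.2.le
        · have hc'C' : c' ∈ C' := by
            refine Finset.mem_filter.mpr ⟨Finset.mem_filter.mpr ⟨hc', hac.trans h1, ?_⟩, h1⟩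
            exact h2.trans_le (Finset.mem_filter.mp (Finset.mem_filter.mp (Finset.min'_mem C' hC'ne)).1).2.2.le
          exact absurd (Finset.min'_le C' c' hc'C') (not_le.mpr h2)
    obtain ⟨c₂, hcc₂, hc₂b, hgap⟩ := hc₂
    set a' := (a + c) / 2 with ha'
    set b' := (c + c₂) / 2 with hb'
    have haa' : a < a' := by rw [ha']; linarith
    have ha'c : a' < c := by rw [ha']; linarith
    have hcb' : c < b' := by rw [hb']; linarith
    have hb'c₂ : b' < c₂ := by rw [hb']; linarith
    have hb'b : b' ≤ b := by linarith
    -- `a'` and `b'` are not critical, hence injective parameters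
    have ha'crit : a' ∉ crit E u v := fun h => absurd (hcmin a' (Finset.mem_filter.mpr ⟨h, haa', by linarith⟩)) (not_le.mpr ha'c)
    have hb'crit : b' ∉ crit E u v := fun h => hgap b' h hcb' hb'c₂
    have ha'inj : Set.InjOn (hgt u v a') E := injOn_of_not_mem_crit E u v ha ha'crit
    have hb'inj : Set.InjOn (hgt u v b') E := injOn_of_not_mem_crit E u v ha hb'crit
    -- (i) from `a` to `a'`: nothing critical in `[a, a']`
    have hfree₁ : ∀ c' ∈ crit E u v, ¬ (a ≤ c' ∧ c' ≤ a') := by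
      rintro c' hc' ⟨h1, h2⟩
      rcases h1.lt_or_eq with h1 | h1
      · exact absurd (hcmin c' (Finset.mem_filter.mpr ⟨hc', h1, by linarith⟩)) (not_le.mpr (by linarith))
      · exact haC (h1 ▸ hc')
    have hG₁ : GreedyGale.gset (K := K) E x (hgt u v a) = GreedyGale.gset (K := K) E x (hgt u v a') :=
      gset_congr E x fun e he e' he' => lt_iff_lt_of_no_crit E u v haa'.le hfree₁ he he'
    -- (ii) across `c`: the block step between `a'` and `b'`
    have hm := lex_below E u v ha'c (fun c' hc' h1 h2 => le_antisymm h2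
      (hcmin c' (Finset.mem_filter.mpr ⟨hc', by linarith, by linarith⟩)))
    have hp := lex_above E u v hcb' (fun c' hc' h1 h2 => by
      rcases h1.lt_or_eq with h1 | h1
      · exact (hgap c' hc' h1 (by linarith)).elim
      · exact h1.symm)
    have hblock := BlockStep.sum_rk_le (K := K) E x (hgt u v a') (hgt u v b') (hgt u v c) v hm hp ha'inj hb'inj U
      (hU a' ha'inj) (hU b' hb'inj)
    -- (iii) from `b'` to `b` by induction: fewer critical values
    have hcard' : ((crit E u v).filter fun c' => b' < c' ∧ c' < b).card < n := by
      rw [← hcard]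
      apply Finset.card_lt_card
      refine ⟨fun c' hc' => ?_, fun hsub => ?_⟩
      · obtain ⟨hc'crit, h1, h2⟩ := Finset.mem_filter.mp hc'
        exact Finset.mem_filter.mpr ⟨hc'crit, by linarith, h2⟩
      · have := Finset.mem_filter.mp (hsub hcC)
        linarith [this.2.1]
    have hIH := ih _ hcard' b' b hb'b hb'inj hb rfl
    -- assemble
    have e₁ : pot (K := K) E U x u v a = pot (K := K) E U x u v a' := by simp only [pot, hG₁]
    refine ⟨?_, fun heq => ?_⟩
    · calc pot (K := K) E U x u v a = pot (K := K) E U x u v a' := e₁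
        _ ≤ pot (K := K) E U x u v b' := hblock.1
        _ ≤ pot (K := K) E U x u v b := hIH.1
    · have hb1 : pot (K := K) E U x u v a' ≤ pot (K := K) E U x u v b' := hblock.1
      have hI1 : pot (K := K) E U x u v b' ≤ pot (K := K) E U x u v b := hIH.1
      rw [e₁] at heq
      have h2 : pot (K := K) E U x u v a' = pot (K := K) E U x u v b' := by omega
      have h3 : pot (K := K) E U x u v b' = pot (K := K) E U x u v b := by omega
      have q1 : E.filter (fun e => e ∈ GreedyGale.gset (K := K) E x (hgt u v a)) =
          E.filter (fun e => e ∈ GreedyGale.gset (K := K) E x (hgt u v a')) := by simp only [hG₁]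
      rw [q1, hblock.2 h2, hIH.2 h3]

omit [Module.Finite K V] in
/-- Conversion of the registered potential (a sum of `Set.ncard`s over `U`) to `pot`. -/
theorem ncard_sum_eq_pot (E U : Finset α) (x : α → V) (u v : α → ℝ) (hUE : U ⊆ E) (lam : ℝ)
    (hGU : ∀ e ∈ E, e ∈ GreedyGale.gset (K := K) E x (hgt u v lam) → e ∈ U) :
    (∑ e ∈ U, Set.ncard {e' : α | e' ∈ U ∧ e ∈ GreedyGale.gset (K := K) E x (hgt u v lam) ∧ v e' < v e}) =
      pot (K := K) E U x u v lam := by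
  unfold pot
  have hfilt : E.filter (fun e => e ∈ GreedyGale.gset (K := K) E x (hgt u v lam)) =
      U.filter (fun e => e ∈ GreedyGale.gset (K := K) E x (hgt u v lam)) := by
    ext e; simp only [Finset.mem_filter]
    exact ⟨fun h => ⟨hGU e h.1 h.2, h.2⟩, fun h => ⟨hUE h.1, h.2⟩⟩
  rw [hfilt, Finset.sum_filter]
  refine Finset.sum_congr rfl fun e _ => ?_
  by_cases hG : e ∈ GreedyGale.gset (K := K) E x (hgt u v lam)
  · rw [if_pos hG]
    unfold BlockStep.rk
    rw [← Set.ncard_coe_finset]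
    congr 1
    ext e'; simp [hG]
  · rw [if_neg hG]
    have : {e' : α | e' ∈ U ∧ e ∈ GreedyGale.gset (K := K) E x (hgt u v lam) ∧ v e' < v e} = ∅ := by
      ext e'; simp [hG]
    rw [this, Set.ncard_empty]

end Induction

end Sweep

/-- **Theorem Q, part Q3 (chart monotonicity of the rank potential).**  Along a chart `λ ↦ u + λ v` with all greedy sets at injective parameters
inside `U ⊆ E`, the `U`-rank potential of the lex-greedy set is monotone in `λ` and separates distinct greedy sets.
[folklore: the parametric-matroid exchange count] -/
theorem lexGreedy_chart_monotone (α : Type) (k : ℕ) (E U : Finset α) (x : α → Fin k → ℂ) (u v : α → ℝ) (hUE : U ⊆ E)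
    (hU : ∀ lam : ℝ, Set.InjOn (fun e => u e + lam * v e) E →
      {e : α | e ∈ E ∧ x e ∉ Submodule.span ℂ (x '' {e' : α | e' ∈ E ∧ u e + lam * v e < u e' + lam * v e'})} ⊆ U)
    (lam₁ lam₂ : ℝ) (hle : lam₁ ≤ lam₂) (h₁ : Set.InjOn (fun e => u e + lam₁ * v e) E)
    (h₂ : Set.InjOn (fun e => u e + lam₂ * v e) E) :
    (∑ e ∈ U, Set.ncard {e' : α | e' ∈ U ∧
        e ∈ {e : α | e ∈ E ∧ x e ∉ Submodule.span ℂ (x '' {e' : α | e' ∈ E ∧ u e + lam₁ * v e < u e' + lam₁ * v e'})} ∧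
        v e' < v e}) ≤
    (∑ e ∈ U, Set.ncard {e' : α | e' ∈ U ∧
        e ∈ {e : α | e ∈ E ∧ x e ∉ Submodule.span ℂ (x '' {e' : α | e' ∈ E ∧ u e + lam₂ * v e < u e' + lam₂ * v e'})} ∧
        v e' < v e}) ∧
    ((∑ e ∈ U, Set.ncard {e' : α | e' ∈ U ∧
        e ∈ {e : α | e ∈ E ∧ x e ∉ Submodule.span ℂ (x '' {e' : α | e' ∈ E ∧ u e + lam₁ * v e < u e' + lam₁ * v e'})} ∧
        v e' < v e}) =
     (∑ e ∈ U, Set.ncard {e' : α | e' ∈ U ∧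
        e ∈ {e : α | e ∈ E ∧ x e ∉ Submodule.span ℂ (x '' {e' : α | e' ∈ E ∧ u e + lam₂ * v e < u e' + lam₂ * v e'})} ∧
        v e' < v e}) →
      {e : α | e ∈ E ∧ x e ∉ Submodule.span ℂ (x '' {e' : α | e' ∈ E ∧ u e + lam₁ * v e < u e' + lam₁ * v e'})} =
      {e : α | e ∈ E ∧ x e ∉ Submodule.span ℂ (x '' {e' : α | e' ∈ E ∧ u e + lam₂ * v e < u e' + lam₂ * v e'})}) := by
  classical
  -- everything is stated for `GreedyGale.gset E x (Sweep.hgt u v lam)`, which is the set-builder above by `rfl`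
  have hU' : ∀ lam : ℝ, Set.InjOn (Sweep.hgt u v lam) E →
      ∀ e ∈ E, e ∈ GreedyGale.gset (K := ℂ) E x (Sweep.hgt u v lam) → e ∈ U :=
    fun lam hinj e _ he => hU lam hinj he
  have hsw := Sweep.sweep (K := ℂ) E U x u v hU' _ lam₁ lam₂ hle h₁ h₂ rfl
  have c₁ := Sweep.ncard_sum_eq_pot (K := ℂ) E U x u v hUE lam₁ (hU' lam₁ h₁)
  have c₂ := Sweep.ncard_sum_eq_pot (K := ℂ) E U x u v hUE lam₂ (hU' lam₂ h₂)
  change (∑ e ∈ U, Set.ncard {e' : α | e' ∈ U ∧ e ∈ GreedyGale.gset (K := ℂ) E x (Sweep.hgt u v lam₁) ∧ v e' < v e}) ≤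
      (∑ e ∈ U, Set.ncard {e' : α | e' ∈ U ∧ e ∈ GreedyGale.gset (K := ℂ) E x (Sweep.hgt u v lam₂) ∧ v e' < v e}) ∧
    ((∑ e ∈ U, Set.ncard {e' : α | e' ∈ U ∧ e ∈ GreedyGale.gset (K := ℂ) E x (Sweep.hgt u v lam₁) ∧ v e' < v e}) =
      (∑ e ∈ U, Set.ncard {e' : α | e' ∈ U ∧ e ∈ GreedyGale.gset (K := ℂ) E x (Sweep.hgt u v lam₂) ∧ v e' < v e}) →
      GreedyGale.gset (K := ℂ) E x (Sweep.hgt u v lam₁) = GreedyGale.gset (K := ℂ) E x (Sweep.hgt u v lam₂))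
  rw [c₁, c₂]
  refine ⟨hsw.1, fun heq => ?_⟩
  have hfilt := hsw.2 heq
  ext e
  constructor
  · intro he
    have : e ∈ E.filter (fun e => e ∈ GreedyGale.gset (K := ℂ) E x (Sweep.hgt u v lam₁)) :=
      Finset.mem_filter.mpr ⟨he.1, he⟩
    rw [hfilt] at this
    exact (Finset.mem_filter.mp this).2
  · intro he
    have : e ∈ E.filter (fun e => e ∈ GreedyGale.gset (K := ℂ) E x (Sweep.hgt u v lam₂)) :=
      Finset.mem_filter.mpr ⟨he.1, he⟩
    rw [← hfilt] at this
    exact (Finset.mem_filter.mp this).2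

end Summit.ValiantsHypothesis.ValiantsHypothesis.Theorems.NewtonUnitEquationsDissociatedUniform
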